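import Mathlib
import Literature.Analysis.FluidPDE.SuitableWeak
import Literature.Analysis.FluidPDE.WeakSolution
import Literature.Analysis.FluidPDE.Seregin2023.TypeIIEulerZoom
import Literature.Analysis.FluidPDE.SuitableWeakRightContinuity
import Literature.Analysis.FluidPDE.LocalLeraySlabGoodSlices
import Summits.NavierStokesRegularity.NavierStokesRegularity.Theorems.EulerZoomLiouvillePowerGaugeEulerLiouvilleConfinedTools
import Summits.NavierStokesRegularity.NavierStokesRegularity.Theorems.EulerZoomLiouvillePowerGaugeEulerLiouvilleBackwardVanishing
import HarnessLib

/-!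
# The CONFINED stratum of the crux `EulerZoomLiouville.PowerGaugeEulerLiouville`: no Euler collapse
# from zero for spatially confined members (local energy inequality + backward vanishing)

Route `EulerZoomLiouville` (NavierStokesRegularity), crux E = stmt-NavierStokesRegularity-19832
`PowerGaugeEulerLiouville`: an ancient local-energy Euler flow `(u, p)` on `(−∞, 0) × ℝ³` (suitable weak,
`ν = 0`, `f = 0`, weak spatial gradient `H`) in Seregin's power-gauged class
`a^{2ρ} A(a) + a^{ρ} E(a) + a^{2ρ} D(a) ≤ c` (all `a > 0`) vanishes a.e.  The crux is OPEN on the window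
`0 < ρ ≤ 1/2` (it contains the Chae–Shvydkoy window for self-similar Euler collapse); the lead's line
`Cruxes/PowerGaugeEulerLiouville/Lines/birth.lean` cuts it as `stub_largeRho` (landed) →
`stub_backwardVanishing` (every member VANISHES BACKWARD on fixed balls along density-one times) →
`stub_noCollapseFromZero` (OPEN core: a backward-vanishing member is trivial — «no Euler collapse out of
zero»).  This file proves the open core stub on the stratum of SPATIALLY CONFINED members
(`u(t, x) = 0` for `‖x‖ ≥ R`, all `t < 0`), for every exponent `ρ`:

* `ae_eq_zero_of_gauge_of_confined` — **class member + backward vanishing (the registered hypothesis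
  `VanishesBackward u` of stub 3, verbatim) + spatial confinement ⇒ `u = 0` a.e.**;
* `noCollapseFromZero_confined` — the same in the registered binder shape of `Sig.stub_noCollapseFromZero`
  (plus the confinement hypothesis).

Mechanism — the first stratum of E that USES the local energy inequality, in the flux-free geometry: with a
bump `φ ≡ 1` on the confinement ball the flux `(|u|² + 2p) u·∇φ` vanishes identically and `ν = 0` kills the
dissipative terms, so the tree's sliced inequality from a.e. starting time (`SuitableRestart.ae_energy_le_of_start_Ioo`,
CKN 1982 (2.5)) gives `e(t) = ∫ |u(t)|² φ ≤ e(s₀)` for a.e. `s₀ < t` — NO ENERGY CREATION; backward vanishing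
supplies good `s₀ < −N` with `e(s₀) ≤ ε`; hence `e = 0` a.e. and `u = 0` a.e.  The `|u|³ ∈ L¹_loc` input comes
from the gauges (`…ConfinedTools.locallyIntegrableOn_cube_of_gauge`).
WHAT THIS IS NOT: not NS regularity and not the open core — self-similar / DSS collapse profiles are not
spatially confined (their tails `|V| ~ |y|^{−(1+ρ)}` are exactly what feeds energy in from infinity); a
kernel-checked stratum `--supports` stmt-19832; `powerGaugeEulerLiouville_confined` composes it BY NAME with the
landed stub 2 (`Backward.stub_backwardVanishing`, ns-typeII-p2 p480952): confined members vanish, every `ρ > 0`. [folklore]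
-/

noncomputable section

set_option linter.dupNamespace false

open MeasureTheory Set Filter Topology Metric Function TopologicalSpace
open scoped ENNReal NNReal InnerProductSpace RealInnerProductSpace Laplacian

namespace Summit.NavierStokesRegularity.NavierStokesRegularity.Theorems.PowerGaugeEulerLiouville

open Literature.Analysis Literature.Analysis.FunctionSpaces Literature.Analysis.FluidPDE

/-! ## Two small inputs (private copies, keeping this file out of the route's import cone) -/

/-- The `A`-part of the gauge as a scaled local-energy bound (copy of
`hasScaledLocalEnergyBound_of_gauge`, `…Irrotational.lean`). [folklore] -/
private theorem hasScaledLocalEnergyBound_of_gauge'' {ρ : ℝ}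
    {u : ℝ → EuclideanSpace ℝ (Fin 3) → EuclideanSpace ℝ (Fin 3)} {p : ℝ → EuclideanSpace ℝ (Fin 3) → ℝ}
    {H : ℝ → EuclideanSpace ℝ (Fin 3) → EuclideanSpace ℝ (Fin 3) →L[ℝ] EuclideanSpace ℝ (Fin 3)} {c : ℝ≥0}
    (hc : ∀ a : ℝ, 0 < a → ENNReal.ofReal (a ^ (2 * ρ)) * cknA a (0 : ℝ × EuclideanSpace ℝ (Fin 3)) u +
        ENNReal.ofReal (a ^ ρ) * cknE a (0 : ℝ × EuclideanSpace ℝ (Fin 3)) H +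
        ENNReal.ofReal (a ^ (2 * ρ)) * cknD a (0 : ℝ × EuclideanSpace ℝ (Fin 3)) p ≤ (c : ℝ≥0∞)) :
    Seregin2023.HasScaledLocalEnergyBound (1 - 2 * ρ) c u := by
  intro a ha s hs
  have hAterm : ENNReal.ofReal (a ^ (2 * ρ)) * cknA a (0 : ℝ × EuclideanSpace ℝ (Fin 3)) u ≤ (c : ℝ≥0∞) :=
    le_trans (le_trans le_self_add le_self_add) (hc a ha)
  have hslice : (ENNReal.ofReal a)⁻¹ * ∫⁻ x in ball (0 : EuclideanSpace ℝ (Fin 3)) a, ‖u s x‖ₑ ^ 2 ≤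
      cknA a (0 : ℝ × EuclideanSpace ℝ (Fin 3)) u := by
    unfold cknA
    have hs' : s ∈ Ioo ((0 : ℝ × EuclideanSpace ℝ (Fin 3)).1 - a ^ 2) (0 : ℝ × EuclideanSpace ℝ (Fin 3)).1 := by
      simpa using hs
    exact le_iSup₂ (f := fun t (_ : t ∈ Ioo ((0 : ℝ × EuclideanSpace ℝ (Fin 3)).1 - a ^ 2)
      (0 : ℝ × EuclideanSpace ℝ (Fin 3)).1) =>
      (ENNReal.ofReal a)⁻¹ * ∫⁻ x in ball (0 : ℝ × EuclideanSpace ℝ (Fin 3)).2 a, ‖u t x‖ₑ ^ 2) s hs'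
  have hB0 : ENNReal.ofReal (a ^ (2 * ρ)) ≠ 0 := by
    rw [ENNReal.ofReal_ne_zero_iff]; exact Real.rpow_pos_of_pos ha _
  have hA0 : ENNReal.ofReal a ≠ 0 := by rw [ENNReal.ofReal_ne_zero_iff]; exact ha
  have h2 : ENNReal.ofReal (a ^ (2 * ρ)) *
      ((ENNReal.ofReal a)⁻¹ * ∫⁻ x in ball (0 : EuclideanSpace ℝ (Fin 3)) a, ‖u s x‖ₑ ^ 2) ≤ (c : ℝ≥0∞) :=
    le_trans (mul_le_mul_right hslice _) hAterm
  have h3 : ∫⁻ x in ball (0 : EuclideanSpace ℝ (Fin 3)) a, ‖u s x‖ₑ ^ 2 ≤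
      ENNReal.ofReal a * (ENNReal.ofReal (a ^ (2 * ρ)))⁻¹ * (c : ℝ≥0∞) := by
    have key : ∫⁻ x in ball (0 : EuclideanSpace ℝ (Fin 3)) a, ‖u s x‖ₑ ^ 2 =
        ENNReal.ofReal a * (ENNReal.ofReal (a ^ (2 * ρ)))⁻¹ *
          (ENNReal.ofReal (a ^ (2 * ρ)) *
            ((ENNReal.ofReal a)⁻¹ * ∫⁻ x in ball (0 : EuclideanSpace ℝ (Fin 3)) a, ‖u s x‖ₑ ^ 2)) := by
      rw [← mul_assoc, mul_assoc (ENNReal.ofReal a), ENNReal.inv_mul_cancel hB0 ENNReal.ofReal_ne_top,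
        mul_one, ← mul_assoc, ENNReal.mul_inv_cancel hA0 ENNReal.ofReal_ne_top, one_mul]
    rw [key]
    exact mul_le_mul_right h2 _
  refine le_trans h3 (le_of_eq ?_)
  rw [← ENNReal.ofReal_inv_of_pos (Real.rpow_pos_of_pos ha _), ← ENNReal.ofReal_mul ha.le,
    ENNReal.coe_nnreal_eq, ← ENNReal.ofReal_mul (by positivity)]
  congr 1
  rw [mul_comm, Real.rpow_sub ha, Real.rpow_one, div_eq_mul_inv]

/-- For a.e. `t < 0` the slice `H t` is a weak gradient of `u t` on `ℝ³` (copy of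
`ae_hasWeakGradient_slice_of_slab`, `…Irrotational.lean`). [folklore] -/
private theorem ae_hasWeakGradient_slice_of_slab''
    {u : ℝ → EuclideanSpace ℝ (Fin 3) → EuclideanSpace ℝ (Fin 3)}
    {H : ℝ → EuclideanSpace ℝ (Fin 3) → EuclideanSpace ℝ (Fin 3) →L[ℝ] EuclideanSpace ℝ (Fin 3)}
    (hH : HasWeakSpatialGradientOn (slab (EuclideanSpace ℝ (Fin 3)) (Iio 0) isOpen_Iio) u H) :
    ∀ᵐ t ∂(volume.restrict (Iio (0 : ℝ))), HasWeakGradient (u t) (H t) := by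
  have hU : (⋃ n : ℕ, Ioo (-((n : ℝ) + 1)) 0) = Iio (0 : ℝ) := by
    refine subset_antisymm (iUnion_subset fun n t ht => ht.2) fun t ht => ?_
    obtain ⟨n, hn⟩ := exists_nat_gt (-t)
    exact mem_iUnion.2 ⟨n, ⟨by linarith, ht⟩⟩
  rw [← hU, ae_restrict_iUnion_iff]
  intro n
  have hn : HasWeakSpatialGradientOn (slab (EuclideanSpace ℝ (Fin 3)) (Ioo (-((n : ℝ) + 1)) 0) isOpen_Ioo) u H :=
    hH.mono (slab_mono Ioo_subset_Iio_self)
  exact hn.ae_hasWeakFDerivOn_slice_slab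

/-! ## The confined stratum: no collapse from zero for spatially confined members -/

/-- **No Euler collapse from zero for spatially CONFINED members of the gauged class.**  Let `(u, p)`
be a suitable weak Euler flow on `(−∞,0) × ℝ³` with weak gradient `H` in Seregin's power-gauged class
(any `ρ`), which VANISHES BACKWARD on fixed balls along density-one sets of times (the conclusion of
the line's stub `stub_backwardVanishing`, verbatim) and is spatially confined: `u(t, x) = 0` for
`‖x‖ ≥ R`, `t < 0`.  Then `u = 0` a.e.  Mechanism (the line's «no collapse from zero», in the
flux-free geometry): by the local energy inequality with `ν = 0` and a bump `φ ≡ 1` on the confinement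
ball, the energy `e(t) = ∫ |u(t)|² φ` cannot increase from almost every starting time (tree
`SuitableRestart.ae_energy_le_of_start_Ioo`; the flux `(|u|² + 2p) u·∇φ` vanishes identically), while
backward vanishing supplies arbitrarily early starting times with `e(s₀) ≤ ε`. [folklore] -/
theorem ae_eq_zero_of_gauge_of_confined {ρ : ℝ}
    {u : ℝ → EuclideanSpace ℝ (Fin 3) → EuclideanSpace ℝ (Fin 3)} {p : ℝ → EuclideanSpace ℝ (Fin 3) → ℝ}
    {H : ℝ → EuclideanSpace ℝ (Fin 3) → EuclideanSpace ℝ (Fin 3) →L[ℝ] EuclideanSpace ℝ (Fin 3)} {c : ℝ≥0}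
    (hsw : IsSuitableWeakSolutionOn (slab (EuclideanSpace ℝ (Fin 3)) (Iio 0) isOpen_Iio) 0 0 u p)
    (hH : HasWeakSpatialGradientOn (slab (EuclideanSpace ℝ (Fin 3)) (Iio 0) isOpen_Iio) u H)
    (hc : ∀ a : ℝ, 0 < a → ENNReal.ofReal (a ^ (2 * ρ)) * cknA a (0 : ℝ × EuclideanSpace ℝ (Fin 3)) u +
        ENNReal.ofReal (a ^ ρ) * cknE a (0 : ℝ × EuclideanSpace ℝ (Fin 3)) H +
        ENNReal.ofReal (a ^ (2 * ρ)) * cknD a (0 : ℝ × EuclideanSpace ℝ (Fin 3)) p ≤ (c : ℝ≥0∞))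
    (hvb : ∀ R ε : ℝ, 0 < R → 0 < ε →
      Tendsto (fun a : ℝ =>
        volume {τ : ℝ | τ ∈ Ioo (-(a ^ 2)) 0 ∧
            ENNReal.ofReal ε < ∫⁻ y in ball (0 : EuclideanSpace ℝ (Fin 3)) R, ‖u τ y‖ₑ ^ 2} /
          ENNReal.ofReal (a ^ 2)) atTop (𝓝 0))
    (hconf : ∃ R : ℝ, ∀ t : ℝ, t < 0 → ∀ x : EuclideanSpace ℝ (Fin 3), R ≤ ‖x‖ → u t x = 0) :
    uncurry u =ᵐ[volume.restrict (Iio (0 : ℝ) ×ˢ (univ : Set (EuclideanSpace ℝ (Fin 3))))] 0 := by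
  obtain ⟨R, hR⟩ := hconf
  set R₁ : ℝ := max R 1 with hR₁def
  have hR₁ : 0 < R₁ := lt_of_lt_of_le one_pos (le_max_right _ _)
  have hconf₁ : ∀ t : ℝ, t < 0 → ∀ x : EuclideanSpace ℝ (Fin 3), R₁ ≤ ‖x‖ → u t x = 0 :=
    fun t ht x hx => hR t ht x ((le_max_left _ _).trans hx)
  -- gauge pieces
  have hE : ∀ a : ℝ, 0 < a →
      ENNReal.ofReal (a ^ ρ) * cknE a (0 : ℝ × EuclideanSpace ℝ (Fin 3)) H ≤ (c : ℝ≥0∞) :=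
    fun a ha => le_trans (le_trans le_add_self le_self_add) (hc a ha)
  have hA := hasScaledLocalEnergyBound_of_gauge'' hc
  have hu3 := locallyIntegrableOn_cube_of_gauge hsw hH hE
  -- the bump `φ ≡ 1` on `B(0, R₁ + 1)`, supported in `B(0, R₁ + 2)`
  obtain ⟨φ, hφ, hφc, hφ0, hφ1, hφone, hφgrad, hφsupp⟩ :=
    exists_bump_eq_one_ball (r := R₁ + 1) (by linarith)
  have hφsupp' : ∀ x, φ x ≠ 0 → x ∈ ball (0 : EuclideanSpace ℝ (Fin 3)) (R₁ + 2) := fun x hx => by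
    have := hφsupp x hx; rw [mem_ball_zero_iff] at this ⊢; linarith
  -- the flux integrand vanishes identically at negative times
  have hflux : ∀ t : ℝ, t < 0 → ∀ x : EuclideanSpace ℝ (Fin 3),
      ‖u t x‖ ^ 2 * (0 * Δ φ x) + (‖u t x‖ ^ 2 + 2 * p t x) * ⟪u t x, gradient φ x⟫ = 0 := by
    intro t ht x
    by_cases hx : ‖x‖ < R₁ + 1
    · rw [hφgrad x (mem_ball_zero_iff.2 hx)]; simp
    · rw [hconf₁ t ht x (by linarith)]; simp
  -- the energy against `φ`
  set e : ℝ → ℝ := fun t => ∫ x, ‖u t x‖ ^ 2 * φ x with hedef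
  -- (1) monotonicity from almost every starting time (local energy inequality, `ν = 0`, no flux)
  have hslab : ∀ n : ℕ, Ioo (-((n : ℝ) + 2)) 0 ×ˢ (univ : Set (EuclideanSpace ℝ (Fin 3))) ⊆
      ((slab (EuclideanSpace ℝ (Fin 3)) (Iio 0) isOpen_Iio : Opens (ℝ × EuclideanSpace ℝ (Fin 3))) :
        Set (ℝ × EuclideanSpace ℝ (Fin 3))) := by
    intro n z hz
    rw [SetLike.mem_coe, mem_slab]
    exact hz.1.2
  have hmono : ∀ n : ℕ, ∀ᵐ s₀ ∂(volume : Measure ℝ), s₀ ∈ Ioo (-((n : ℝ) + 1)) (-(1 / ((n : ℝ) + 1))) →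
      ∀ᵐ t ∂(volume : Measure ℝ), t ∈ Ioo s₀ (-(1 / ((n : ℝ) + 1))) → e t ≤ e s₀ := by
    intro n
    have hn1 : (0 : ℝ) < 1 / ((n : ℝ) + 1) := by positivity
    have h := SuitableRestart.ae_energy_le_of_start_Ioo hsw le_rfl hu3 (hslab n) hφ hφc hφ0
      (a' := -((n : ℝ) + 1)) (b' := -(1 / ((n : ℝ) + 1))) (by linarith) (by linarith)
    filter_upwards [h] with s₀ hs₀ hs₀mem
    filter_upwards [hs₀ hs₀mem] with t ht htmem
    have hzero : ∫ z in Ico s₀ t ×ˢ (univ : Set (EuclideanSpace ℝ (Fin 3))),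
        (‖u z.1 z.2‖ ^ 2 * (0 * Δ φ z.2) + (‖u z.1 z.2‖ ^ 2 + 2 * p z.1 z.2) * ⟪u z.1 z.2, gradient φ z.2⟫) = 0 := by
      refine setIntegral_eq_zero_of_forall_eq_zero fun z hz => ?_
      have hzt : z.1 < 0 := lt_trans (lt_of_lt_of_le hz.1.2 le_rfl) (lt_trans htmem.2 (by linarith))
      exact hflux z.1 hzt z.2
    have := ht htmem
    rw [hzero, add_zero] at this
    exact this
  -- (2) a.e. slice regularity
  have hreg : ∀ᵐ s ∂(volume : Measure ℝ), s < 0 → AEStronglyMeasurable (u s) volume := by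
    have h := ae_hasWeakGradient_slice_of_slab'' hH
    rw [ae_restrict_iff' measurableSet_Iio] at h
    filter_upwards [h] with s hs hslt
    have hl : LocallyIntegrable (u s) volume := locallyIntegrableOn_univ.1 (by
      simpa only [Opens.coe_top] using (hs hslt).locallyIntegrableOn)
    exact hl.aestronglyMeasurable
  -- (3) good starting times
  have hgood : ∀ᵐ s₀ ∂(volume : Measure ℝ), s₀ < 0 →
      (∀ n : ℕ, s₀ ∈ Ioo (-((n : ℝ) + 1)) (-(1 / ((n : ℝ) + 1))) →
        ∀ᵐ t ∂(volume : Measure ℝ), t ∈ Ioo s₀ (-(1 / ((n : ℝ) + 1))) → e t ≤ e s₀) ∧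
      AEStronglyMeasurable (u s₀) volume := by
    filter_upwards [ae_all_iff.2 hmono, hreg] with s₀ h1 h2 hs₀
    exact ⟨fun n => h1 n, h2 hs₀⟩
  -- (4) early good times with small local energy, from backward vanishing
  have hpick : ∀ m N : ℕ, ∃ s₀ : ℝ, s₀ < -(N : ℝ) ∧
      ((∀ n : ℕ, s₀ ∈ Ioo (-((n : ℝ) + 1)) (-(1 / ((n : ℝ) + 1))) →
        ∀ᵐ t ∂(volume : Measure ℝ), t ∈ Ioo s₀ (-(1 / ((n : ℝ) + 1))) → e t ≤ e s₀) ∧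
      AEStronglyMeasurable (u s₀) volume) ∧
      ∫⁻ y in ball (0 : EuclideanSpace ℝ (Fin 3)) (R₁ + 2), ‖u s₀ y‖ₑ ^ 2 ≤ ENNReal.ofReal (1 / ((m : ℝ) + 1)) := by
    intro m N
    set ε : ℝ := 1 / ((m : ℝ) + 1) with hε
    have hε0 : 0 < ε := by positivity
    have hlim := hvb (R₁ + 2) ε (by linarith) hε0
    set Bad : ℝ → Set ℝ := fun a => {τ : ℝ | τ ∈ Ioo (-(a ^ 2)) 0 ∧
      ENNReal.ofReal ε < ∫⁻ y in ball (0 : EuclideanSpace ℝ (Fin 3)) (R₁ + 2), ‖u τ y‖ₑ ^ 2} with hBad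
    have hev1 : ∀ᶠ a : ℝ in atTop, volume (Bad a) / ENNReal.ofReal (a ^ 2) < 1 / 2 :=
      (tendsto_order.1 hlim).2 _ (by norm_num)
    have hev2 : ∀ᶠ a : ℝ in atTop, 2 * (N : ℝ) + 2 < a ^ 2 := by
      refine (tendsto_pow_atTop two_ne_zero).eventually_gt_atTop _
    obtain ⟨a, ha1, ha2, ha0⟩ := (hev1.and (hev2.and (eventually_gt_atTop 0))).exists
    have ha2pos : 0 < a ^ 2 := by positivity
    have hBadlt : volume (Bad a) < 1 / 2 * ENNReal.ofReal (a ^ 2) := by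
      rwa [ENNReal.div_lt_iff (Or.inl ((ENNReal.ofReal_pos.2 ha2pos).ne')) (Or.inl ENNReal.ofReal_ne_top)] at ha1
    set A : Set ℝ := Ioo (-(a ^ 2)) (-(N : ℝ)) \ Bad a with hAdef
    have hApos : volume A ≠ 0 := by
      intro hA0
      have h1 : volume (Ioo (-(a ^ 2)) (-(N : ℝ))) - volume (Bad a) ≤ volume A := le_measure_sdiff
      rw [hA0, nonpos_iff_eq_zero, tsub_eq_zero_iff_le, Real.volume_Ioo] at h1
      have h2 : ENNReal.ofReal (-(N : ℝ) - -(a ^ 2)) < 1 / 2 * ENNReal.ofReal (a ^ 2) := lt_of_le_of_lt h1 hBadlt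
      rw [show (1 / 2 : ℝ≥0∞) = ENNReal.ofReal (1 / 2) by rw [ENNReal.ofReal_div_of_pos two_pos]; simp,
        ← ENNReal.ofReal_mul (by norm_num), ENNReal.ofReal_lt_ofReal_iff (by positivity)] at h2
      linarith
    -- the good set has full measure, so `A` meets it
    have hGc : volume {s : ℝ | ¬ (s < 0 →
        (∀ n : ℕ, s ∈ Ioo (-((n : ℝ) + 1)) (-(1 / ((n : ℝ) + 1))) →
          ∀ᵐ t ∂(volume : Measure ℝ), t ∈ Ioo s (-(1 / ((n : ℝ) + 1))) → e t ≤ e s) ∧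
        AEStronglyMeasurable (u s) volume)} = 0 := ae_iff.1 hgood
    obtain ⟨s₀, hs₀A, hs₀G⟩ : ∃ s₀, s₀ ∈ A ∧ (s₀ < 0 →
        (∀ n : ℕ, s₀ ∈ Ioo (-((n : ℝ) + 1)) (-(1 / ((n : ℝ) + 1))) →
          ∀ᵐ t ∂(volume : Measure ℝ), t ∈ Ioo s₀ (-(1 / ((n : ℝ) + 1))) → e t ≤ e s₀) ∧
        AEStronglyMeasurable (u s₀) volume) := by
      by_contra hne
      apply hApos
      refine measure_mono_null (fun s hs => ?_) hGc
      intro hgoods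
      exact hne ⟨s, hs, hgoods⟩
    have hs₀N : s₀ < -(N : ℝ) := hs₀A.1.2
    have hs₀neg : s₀ < 0 := lt_of_lt_of_le hs₀N (by simp)
    refine ⟨s₀, hs₀N, hs₀G hs₀neg, ?_⟩
    have hnot : ¬ (ENNReal.ofReal ε < ∫⁻ y in ball (0 : EuclideanSpace ℝ (Fin 3)) (R₁ + 2), ‖u s₀ y‖ₑ ^ 2) := by
      intro hlt
      exact hs₀A.2 ⟨⟨hs₀A.1.1, hs₀neg⟩, hlt⟩
    exact not_lt.1 hnot
  choose S hSN hSgood hSsmall using hpick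
  -- (5) the energy at the picked times is small
  have heS : ∀ m N : ℕ, e (S m N) ≤ 1 / ((m : ℝ) + 1) := by
    intro m N
    have hfin : ∫⁻ y in ball (0 : EuclideanSpace ℝ (Fin 3)) (R₁ + 2), ‖u (S m N) y‖ₑ ^ 2 < ⊤ :=
      lt_of_le_of_lt (hSsmall m N) ENNReal.ofReal_lt_top
    obtain ⟨-, hle⟩ := integrable_sq_mul_of_lintegral_ball (hSgood m N).2 hfin hφ.continuous hφ0 hφ1 hφsupp'
    refine hle.trans ?_
    have := ENNReal.toReal_mono ENNReal.ofReal_ne_top (hSsmall m N)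
    rwa [ENNReal.toReal_ofReal (by positivity)] at this
  -- (6) for a.e. `t < 0`: `e t ≤ 1/(m+1)` for every `m`, hence `e t ≤ 0`
  have hall : ∀ᵐ t ∂(volume : Measure ℝ), ∀ m N n : ℕ,
      S m N ∈ Ioo (-((n : ℝ) + 1)) (-(1 / ((n : ℝ) + 1))) →
        t ∈ Ioo (S m N) (-(1 / ((n : ℝ) + 1))) → e t ≤ e (S m N) :=
    ae_all_iff.2 fun m => ae_all_iff.2 fun N => ae_all_iff.2 fun n => by
      by_cases hmem : S m N ∈ Ioo (-((n : ℝ) + 1)) (-(1 / ((n : ℝ) + 1)))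
      · filter_upwards [(hSgood m N).1 n hmem] with t ht _ htmem
        exact ht htmem
      · exact Eventually.of_forall fun t h => (hmem h).elim
  have he0 : ∀ᵐ t ∂(volume : Measure ℝ), t < 0 → e t ≤ 0 := by
    filter_upwards [hall] with t ht htneg
    have hbound : ∀ m : ℕ, e t ≤ 1 / ((m : ℝ) + 1) := by
      intro m
      set N : ℕ := ⌈-t⌉₊ with hN
      have hSt : S m N < t := by
        have h1 : -t ≤ (N : ℝ) := Nat.le_ceil _
        have h2 := hSN m N
        linarith
      set s := S m N with hs
      set n : ℕ := ⌈-s⌉₊ + ⌈1 / (-t)⌉₊ with hn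
      have hn1 : -((n : ℝ) + 1) < s := by
        have h1 : -s ≤ (⌈-s⌉₊ : ℝ) := Nat.le_ceil _
        have h2 : (n : ℝ) = (⌈-s⌉₊ : ℝ) + (⌈1 / (-t)⌉₊ : ℝ) := by rw [hn]; push_cast; ring
        have h3 : (0 : ℝ) ≤ (⌈1 / (-t)⌉₊ : ℝ) := by positivity
        linarith
      have hn2 : t < -(1 / ((n : ℝ) + 1)) := by
        have h1 : 1 / (-t) ≤ (⌈1 / (-t)⌉₊ : ℝ) := Nat.le_ceil _
        have h2 : (n : ℝ) = (⌈-s⌉₊ : ℝ) + (⌈1 / (-t)⌉₊ : ℝ) := by rw [hn]; push_cast; ring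
        have h3 : (0 : ℝ) ≤ (⌈-s⌉₊ : ℝ) := by positivity
        have h4 : 1 / (-t) < (n : ℝ) + 1 := by linarith
        have hnt : 0 < -t := by linarith
        rw [div_lt_iff₀ hnt] at h4
        have h5 : 1 / ((n : ℝ) + 1) < -t := by
          rw [div_lt_iff₀ (by positivity), mul_comm]; exact h4
        linarith
      have hsmem : s ∈ Ioo (-((n : ℝ) + 1)) (-(1 / ((n : ℝ) + 1))) := ⟨hn1, hSt.trans hn2⟩
      exact (ht m N n hsmem ⟨hSt, hn2⟩).trans (heS m N)
    have hlim : Tendsto (fun m : ℕ => 1 / ((m : ℝ) + 1)) atTop (𝓝 0) := tendsto_one_div_add_atTop_nhds_zero_nat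
    exact ge_of_tendsto' hlim hbound
  -- (7) slices at good times vanish
  have hslice0 : ∀ᵐ t ∂(volume.restrict (Iio (0 : ℝ))), u t =ᵐ[volume] 0 := by
    rw [ae_restrict_iff' measurableSet_Iio]
    filter_upwards [he0, hreg] with t het hregt htmem
    have htneg : t < 0 := htmem
    have hmeas := hregt htneg
    -- finite local energy of the slice on a big ball (the `A`-gauge)
    set a : ℝ := max (R₁ + 2) (Real.sqrt (-t) + 1) with ha
    have ha0 : 0 < a := lt_of_lt_of_le (by linarith) (le_max_left _ _)
    have hta : t ∈ Ioo (-(a ^ 2)) 0 := by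
      refine ⟨?_, htneg⟩
      have h1 : Real.sqrt (-t) ^ 2 = -t := Real.sq_sqrt (by linarith)
      have h2 : Real.sqrt (-t) + 1 ≤ a := le_max_right _ _
      nlinarith [Real.sqrt_nonneg (-t)]
    have hfin : ∫⁻ y in ball (0 : EuclideanSpace ℝ (Fin 3)) (R₁ + 2), ‖u t y‖ₑ ^ 2 < ⊤ :=
      lt_of_le_of_lt (lintegral_mono_set (ball_subset_ball (le_max_left _ _)))
        (lt_of_le_of_lt (hA a ha0 t hta) ENNReal.ofReal_lt_top)
    obtain ⟨hint, -⟩ := integrable_sq_mul_of_lintegral_ball hmeas hfin hφ.continuous hφ0 hφ1 hφsupp'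
    have hnn : 0 ≤ᵐ[volume] fun x => ‖u t x‖ ^ 2 * φ x :=
      Eventually.of_forall fun x => mul_nonneg (sq_nonneg _) (hφ0 x)
    have hezero : e t = 0 := le_antisymm (het htneg) (integral_nonneg fun x => mul_nonneg (sq_nonneg _) (hφ0 x))
    have hae := (integral_eq_zero_iff_of_nonneg_ae hnn hint).1 hezero
    filter_upwards [hae] with x hx
    simp only [Pi.zero_apply, mul_eq_zero] at hx ⊢
    by_cases hxR : ‖x‖ < R₁ + 1
    · rcases hx with h | h
      · exact norm_eq_zero.1 (by simpa using h)
      · exact absurd h (by rw [hφone x (mem_ball_zero_iff.2 hxR)]; norm_num)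
    · exact hconf₁ t htneg x (by linarith)
  -- (8) Tonelli on the slab
  have hmeasU : AEStronglyMeasurable (uncurry u)
      (volume.restrict (Iio (0 : ℝ) ×ˢ (univ : Set (EuclideanSpace ℝ (Fin 3))))) := by
    have := hH.locallyIntegrableOn.aestronglyMeasurable
    simpa [slab] using this
  have hint : ∫⁻ z in Iio (0 : ℝ) ×ˢ (univ : Set (EuclideanSpace ℝ (Fin 3))), ‖uncurry u z‖ₑ = 0 := by
    have hm := hmeasU.aemeasurable.enorm
    rw [Measure.volume_eq_prod, ← Measure.restrict_prod_eq_prod_univ] at hm ⊢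
    rw [lintegral_prod _ hm]
    have hz : (fun t : ℝ => ∫⁻ y, ‖uncurry u (t, y)‖ₑ) =ᵐ[volume.restrict (Iio 0)] 0 := by
      filter_upwards [hslice0] with t ht
      have : (fun y => ‖uncurry u (t, y)‖ₑ) =ᵐ[volume] fun _ => 0 := by
        filter_upwards [ht] with y hy
        simp [uncurry, hy]
      rw [lintegral_congr_ae this]
      simp
    rw [lintegral_congr_ae hz]
    simp
  have hae := (lintegral_eq_zero_iff' hmeasU.aemeasurable.enorm).1 hint
  filter_upwards [hae] with z hz
  simpa using hz

/-- **The confined case of the line's open core stub `stub_noCollapseFromZero`, in its registered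
binder shape** (`Cruxes/PowerGaugeEulerLiouville/Lines/birth.lean`: `InClass ρ u p H c → VanishesBackward u →
VanishesAE u`, reducibles unfolded) with the one extra hypothesis of spatial confinement.  The window
restriction `0 < ρ ≤ 1/2` of the stub is carried but not used. [folklore] -/
theorem noCollapseFromZero_confined :
    ∀ ρ : ℝ, 0 < ρ → ρ ≤ 1 / 2 →
      ∀ (u : ℝ → EuclideanSpace ℝ (Fin 3) → EuclideanSpace ℝ (Fin 3)) (p : ℝ → EuclideanSpace ℝ (Fin 3) → ℝ)
        (H : ℝ → EuclideanSpace ℝ (Fin 3) → EuclideanSpace ℝ (Fin 3) →L[ℝ] EuclideanSpace ℝ (Fin 3)) (c : ℝ≥0),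
        (IsSuitableWeakSolutionOn (slab (EuclideanSpace ℝ (Fin 3)) (Set.Iio 0) isOpen_Iio) 0 0 u p ∧
          HasWeakSpatialGradientOn (slab (EuclideanSpace ℝ (Fin 3)) (Set.Iio 0) isOpen_Iio) u H ∧
          (∀ a : ℝ, 0 < a →
            ENNReal.ofReal (a ^ (2 * ρ)) * cknA a (0 : ℝ × EuclideanSpace ℝ (Fin 3)) u +
                ENNReal.ofReal (a ^ ρ) * cknE a (0 : ℝ × EuclideanSpace ℝ (Fin 3)) H +
              ENNReal.ofReal (a ^ (2 * ρ)) * cknD a (0 : ℝ × EuclideanSpace ℝ (Fin 3)) p ≤ (c : ℝ≥0∞))) →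
        (∀ R ε : ℝ, 0 < R → 0 < ε →
          Tendsto (fun a : ℝ =>
            volume {τ : ℝ | τ ∈ Set.Ioo (-(a ^ 2)) 0 ∧
                ENNReal.ofReal ε < ∫⁻ y in ball (0 : EuclideanSpace ℝ (Fin 3)) R, ‖u τ y‖ₑ ^ 2} /
              ENNReal.ofReal (a ^ 2)) atTop (𝓝 0)) →
        (∃ R : ℝ, ∀ t : ℝ, t < 0 → ∀ x : EuclideanSpace ℝ (Fin 3), R ≤ ‖x‖ → u t x = 0) →
        Function.uncurry u =ᵐ[volume.restrict (Set.Iio (0 : ℝ) ×ˢ (Set.univ : Set (EuclideanSpace ℝ (Fin 3))))] 0 :=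
  fun _ _ _ _ _ _ _ hcl hvb hconf => ae_eq_zero_of_gauge_of_confined hcl.1 hcl.2.1 hcl.2.2 hvb hconf

/-- **Spatially confined members of the power-gauged ancient Euler class vanish** — unconditionally, for
every `ρ > 0`: the composition of the line's LANDED stub 2 (`Backward.stub_backwardVanishing`,
ns-typeII-p2, p480952: every member vanishes backward) with the confined case of stub 3
(`noCollapseFromZero_confined`).  The crux VERBATIM plus the one hypothesis of spatial confinement.
[folklore] -/
theorem powerGaugeEulerLiouville_confined :
    ∀ ρ : ℝ, 0 < ρ → ∀ (u : ℝ → EuclideanSpace ℝ (Fin 3) → EuclideanSpace ℝ (Fin 3))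
      (p : ℝ → EuclideanSpace ℝ (Fin 3) → ℝ)
      (H : ℝ → EuclideanSpace ℝ (Fin 3) → EuclideanSpace ℝ (Fin 3) →L[ℝ] EuclideanSpace ℝ (Fin 3)) (c : ℝ≥0),
      IsSuitableWeakSolutionOn (slab (EuclideanSpace ℝ (Fin 3)) (Set.Iio 0) isOpen_Iio) 0 0 u p →
      HasWeakSpatialGradientOn (slab (EuclideanSpace ℝ (Fin 3)) (Set.Iio 0) isOpen_Iio) u H →
      (∀ a : ℝ, 0 < a → ENNReal.ofReal (a ^ (2 * ρ)) * cknA a (0 : ℝ × EuclideanSpace ℝ (Fin 3)) u +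
        ENNReal.ofReal (a ^ ρ) * cknE a (0 : ℝ × EuclideanSpace ℝ (Fin 3)) H +
        ENNReal.ofReal (a ^ (2 * ρ)) * cknD a (0 : ℝ × EuclideanSpace ℝ (Fin 3)) p ≤ (c : ℝ≥0∞)) →
      (∃ R : ℝ, ∀ t : ℝ, t < 0 → ∀ x : EuclideanSpace ℝ (Fin 3), R ≤ ‖x‖ → u t x = 0) →
      Function.uncurry u =ᵐ[volume.restrict (Set.Iio (0 : ℝ) ×ˢ (Set.univ : Set (EuclideanSpace ℝ (Fin 3))))] 0 :=
  fun ρ hρ u p H c hsw hH hc hconf =>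
    ae_eq_zero_of_gauge_of_confined hsw hH hc
      (Backward.stub_backwardVanishing ρ hρ u p H c ⟨hsw, hH, hc⟩) hconf

end Summit.NavierStokesRegularity.NavierStokesRegularity.Theorems.PowerGaugeEulerLiouville

end
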